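import Mathlib
import Summits.Ventures.PercRepro2.Defs
import Summits.Ventures.PercRepro2.Graph
import Summits.Ventures.PercRepro2.Harris
import Summits.Ventures.PercRepro2.Events
import Summits.Ventures.PercRepro2.Independence
import Summits.Ventures.PercRepro2.Induced
import Summits.Ventures.PercRepro2.HullTree
import Summits.Ventures.PercRepro2.SideCluster
import Summits.Ventures.PercRepro2.GateDefs
import Summits.Ventures.PercRepro2.GateAnatomy
import Summits.Ventures.PercRepro2.GateCylinder
import Summits.Ventures.PercRepro2.GateForest
import Summits.Ventures.PercRepro2.GateSplit
import Summits.Ventures.PercRepro2.ForestCluster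

/-!
# Paths, path cylinders and nested avoidance sets on a forest — the combinatorial half of
`GateForestGeneral` (blind cell PercRepro2, mine-c g8; proofs/MINEC-LSMGATE.md §13)

On a forest `{t ↔ b}` is the cylinder of the (chosen) all-open path from `t` to `b` (`hitCyl`,
`hitCyl_eq`), so `{C(t) hits B}` is a union of path cylinders (`hitsUW_eq_iUnion`). For a vertex
set `W` let `avoidB W ⊆ B` be the `b` whose path avoids `W`, and `hitAvoid W` the union of their
cylinders: on `{C(s) = W}` with `t ∉ W` only the avoiding paths can be open
(`clusterEvent_inter_hitsUW`), and `hitAvoid W` depends on edges not touching `W`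
(`dependsOn_hitAvoid`). The key combinatorial fact: the avoidance sets of two rooted subtrees
`W₁, W₂ ∋ s` are NESTED (`avoidB_nested`) — a path meeting `W₂` but not `W₁` and a path meeting
`W₁` but not `W₂` would give, along the unique path between the two meeting points (which lies
both in `W₁ ∪ W₂` and in the union of the two paths), an edge between `W₂ ∖ W₁` and `W₁ ∖ W₂`,
impossible by `ForestCluster.no_cross_edge`.
-/

namespace Summit.Ventures.PercRepro2

namespace GateForestPaths

open scoped Classical

variable {V : Type*} {E : Type*} [Fintype E] [Fintype V]

/-! ## The path cylinders of `{t ↔ b}` on a forest -/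

/-- A chosen path of the all-open graph from `t` to `b`. -/
noncomputable def tbPath (ends : E → Sym2 V) (t b : V)
    (hr : (ForestCluster.allG ends).Reachable t b) : (ForestCluster.allG ends).Path t b :=
  hr.some.toPath

/-- The vertices of the chosen `t–b` path (empty if `b` is unreachable). -/
noncomputable def pathVerts (ends : E → Sym2 V) (t b : V) : Finset V :=
  if hr : (ForestCluster.allG ends).Reachable t b then (tbPath ends t b hr).1.support.toFinset else ∅

/-- The edges of the chosen `t–b` path (empty if unreachable). -/
noncomputable def pathEdges (ends : E → Sym2 V) (t b : V) : Finset E :=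
  if hr : (ForestCluster.allG ends).Reachable t b then GateForest.edgeFinset ends (tbPath ends t b hr).1
  else ∅

/-- The cylinder `{t ↔ b}` (empty if unreachable). -/
noncomputable def hitCyl (ends : E → Sym2 V) (t b : V) : Set (Config E) :=
  if (ForestCluster.allG ends).Reachable t b then GateCylinder.cylinder (pathEdges ends t b) else ∅

/-- On a forest `hitCyl b = {t ↔ b}`. -/
lemma hitCyl_eq {ends : E → Sym2 V} (hF : Hull.IsForest ends) (t b : V) :
    hitCyl ends t b = {ω | Conn ends ω t b} := by
  ext ω
  unfold hitCyl pathEdges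
  by_cases hr : (ForestCluster.allG ends).Reachable t b
  · simp only [hr, if_true, Set.mem_setOf_eq]
    exact (GateForest.conn_iff_cylinder hF (tbPath ends t b hr) ω).symm
  · simp only [hr, if_false, Set.mem_empty_iff_false, Set.mem_setOf_eq, false_iff]
    intro hc
    exact hr (hc.mono (openGraph_mono (Hull.le_allOpen ω)))

/-- `{C(t) hits B}` is the union of the path cylinders. -/
lemma hitsUW_eq_iUnion {ends : E → Sym2 V} (hF : Hull.IsForest ends) (t : V) (B : Finset V) :
    GateSplit.hitsUW ends t B = ⋃ b ∈ B, hitCyl ends t b := by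
  ext ω
  simp only [GateSplit.hitsUW, clusterInEvent, cluster, Set.mem_setOf_eq, Set.mem_iUnion,
    hitCyl_eq hF]
  constructor
  · rintro ⟨x, hx, hc⟩; exact ⟨x, hx, hc⟩
  · rintro ⟨x, hx, hc⟩; exact ⟨x, hx, hc⟩

/-- The endpoints of a path edge lie on the path. -/
lemma mem_pathVerts_of_mem_pathEdges {ends : E → Sym2 V} {t b : V} {e : E} (he : e ∈ pathEdges ends t b)
    {x y : V} (hxy : ends e = s(x, y)) : x ∈ pathVerts ends t b ∧ y ∈ pathVerts ends t b := by
  unfold pathEdges at he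
  unfold pathVerts
  by_cases hr : (ForestCluster.allG ends).Reachable t b
  · rw [dif_pos hr] at he
    rw [dif_pos hr]
    rw [GateForest.mem_edgeFinset, hxy] at he
    exact ⟨List.mem_toFinset.2 ((tbPath ends t b hr).1.fst_mem_support_of_mem_edges he),
      List.mem_toFinset.2 ((tbPath ends t b hr).1.snd_mem_support_of_mem_edges he)⟩
  · rw [dif_neg hr] at he
    exact absurd he (Finset.notMem_empty e)

/-- `hitCyl b` depends on the path edges only. -/
lemma dependsOn_hitCyl (ends : E → Sym2 V) (t b : V) :
    DependsOn (· ∈ hitCyl ends t b) (↑(pathEdges ends t b) : Set E) := by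
  intro ω ω' h
  unfold hitCyl
  by_cases hr : (ForestCluster.allG ends).Reachable t b
  · simp only [hr, if_true]
    show (ω ∈ GateCylinder.cylinder (pathEdges ends t b)) = (ω' ∈ GateCylinder.cylinder (pathEdges ends t b))
    simp only [GateCylinder.cylinder, Set.mem_setOf_eq]
    exact propext (forall_congr' fun e => forall_congr' fun he => by rw [h e (Finset.mem_coe.2 he)])
  · simp [hr]

/-! ## The paths avoiding a cluster -/

variable (ends : E → Sym2 V) (t : V) (B : Finset V)

/-- The `b ∈ B` whose `t–b` path avoids `W`. -/
noncomputable def avoidB (W : Finset V) : Finset V :=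
  B.filter fun b => ∀ v ∈ pathVerts ends t b, v ∉ W

/-- The union of the cylinders of the paths avoiding `W`. -/
noncomputable def hitAvoid (W : Finset V) : Set (Config E) :=
  ⋃ b ∈ avoidB ends t B W, hitCyl ends t b

/-- A path avoids `W₁ ∪ W₂` iff it avoids both. -/
lemma avoidB_union (W₁ W₂ : Finset V) :
    avoidB ends t B (W₁ ∪ W₂) = avoidB ends t B W₁ ∩ avoidB ends t B W₂ := by
  ext b
  simp only [avoidB, Finset.mem_filter, Finset.mem_inter, Finset.mem_union, not_or]
  constructor
  · rintro ⟨hb, h⟩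
    exact ⟨⟨hb, fun v hv => (h v hv).1⟩, ⟨hb, fun v hv => (h v hv).2⟩⟩
  · rintro ⟨⟨hb, h₁⟩, ⟨_, h₂⟩⟩
    exact ⟨hb, fun v hv => ⟨h₁ v hv, h₂ v hv⟩⟩

/-- A path avoiding `W₁` or `W₂` avoids `W₁ ∩ W₂`. -/
lemma avoidB_inter_supset (W₁ W₂ : Finset V) :
    avoidB ends t B W₁ ∪ avoidB ends t B W₂ ⊆ avoidB ends t B (W₁ ∩ W₂) := by
  intro b hb
  simp only [avoidB, Finset.mem_filter, Finset.mem_union, Finset.mem_inter] at hb ⊢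
  rcases hb with ⟨hb, h⟩ | ⟨hb, h⟩
  · exact ⟨hb, fun v hv hv' => h v hv hv'.1⟩
  · exact ⟨hb, fun v hv hv' => h v hv hv'.2⟩

/-- `hitAvoid` is monotone in the index set: a larger `avoidB` gives a larger union. -/
lemma hitAvoid_mono {W₁ W₂ : Finset V} (h : avoidB ends t B W₁ ⊆ avoidB ends t B W₂) :
    hitAvoid ends t B W₁ ⊆ hitAvoid ends t B W₂ := by
  intro ω hω
  simp only [hitAvoid, Set.mem_iUnion] at hω ⊢
  obtain ⟨b, hb, hω⟩ := hω
  exact ⟨b, h hb, hω⟩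

/-- `hitAvoid W` depends on edges not touching `W`. -/
lemma dependsOn_hitAvoid (W : Finset V) :
    DependsOn (· ∈ hitAvoid ends t B W) (touches ends (↑W : Set V))ᶜ := by
  intro ω ω' h
  simp only [hitAvoid, Set.mem_iUnion]
  refine propext (exists_congr fun b => exists_congr fun hb => ?_)
  have key : (fun ω => ω ∈ hitCyl ends t b) ω = (fun ω => ω ∈ hitCyl ends t b) ω' := by
    refine dependsOn_hitCyl ends t b (x := ω) (y := ω') fun e he => h e ?_
    -- an edge of a path avoiding `W` does not touch `W`
    intro ht
    obtain ⟨x, hx, y, hxy⟩ := ht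
    have hb' := (Finset.mem_filter.1 hb).2
    have hv := mem_pathVerts_of_mem_pathEdges (Finset.mem_coe.1 he) hxy
    exact hb' x hv.1 (Finset.mem_coe.1 hx)
  exact Iff.of_eq key

/-! ## The factorisation of the class-`A₂` mass on a forest -/

variable {ends t B}

/-- On `{C(s) = W}` with `t ∉ W`, only the paths avoiding `W` can be open. -/
lemma clusterEvent_inter_hitsUW (hF : Hull.IsForest ends) (s : V) {W : Finset V} (ht : t ∉ W) :
    clusterEvent ends s (↑W : Set V) ∩ GateSplit.hitsUW ends t B =
      clusterEvent ends s (↑W : Set V) ∩ hitAvoid ends t B W := by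
  rw [hitsUW_eq_iUnion hF]
  ext ω
  simp only [Set.mem_inter_iff, Set.mem_iUnion, hitAvoid, avoidB, Finset.mem_filter]
  constructor
  · rintro ⟨hW, b, hb, hω⟩
    refine ⟨hW, b, ⟨hb, fun v hv hvW => ?_⟩, hω⟩
    -- `v` on the open path: `t ↔ v`, and `v ∈ C(s)` gives `t ∈ C(s) = W`
    unfold hitCyl at hω
    by_cases hr : (ForestCluster.allG ends).Reachable t b
    · simp only [hr, if_true] at hω
      unfold pathVerts at hv
      rw [dif_pos hr] at hv
      have hv' : v ∈ (tbPath ends t b hr).1.support := List.mem_toFinset.1 hv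
      have hconn : Conn ends ω t v := by
        refine ⟨((tbPath ends t b hr).1.takeUntil v hv').transfer (openGraph ends ω) fun f hf => ?_⟩
        induction f using Sym2.ind with
        | h x y =>
          have hf' := (tbPath ends t b hr).1.edges_takeUntil_subset_edges hv' hf
          have hadj := (tbPath ends t b hr).1.adj_of_mem_edges hf'
          obtain ⟨hne, e, _, hends⟩ := openGraph_adj.1 hadj
          have he : e ∈ pathEdges ends t b := by
            unfold pathEdges; rw [dif_pos hr, GateForest.mem_edgeFinset, hends]; exact hf'
          rw [SimpleGraph.mem_edgeSet, openGraph_adj]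
          exact ⟨hne, e, hω e he, hends⟩
      have hvs : v ∈ cluster ends ω s := by rw [mem_clusterEvent.1 hW]; exact hvW
      have hts : t ∈ cluster ends ω s := conn_trans hvs (conn_symm hconn)
      rw [mem_clusterEvent.1 hW] at hts
      exact ht hts
    · simp [hr] at hω
  · rintro ⟨hW, b, ⟨hb, _⟩, hω⟩
    exact ⟨hW, b, hb, hω⟩

/-! ## Nestedness of the avoidance sets -/

/-- **The avoidance sets of two rooted subtrees are nested.** -/
lemma avoidB_nested (hF : Hull.IsForest ends) {s : V} {W₁ W₂ : Finset V}
    (h₁ : ForestCluster.IsRootedSub ends s W₁) (h₂ : ForestCluster.IsRootedSub ends s W₂) :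
    avoidB ends t B W₁ ⊆ avoidB ends t B W₂ ∨ avoidB ends t B W₂ ⊆ avoidB ends t B W₁ := by
  by_contra hcon
  rw [not_or, Finset.not_subset, Finset.not_subset] at hcon
  obtain ⟨⟨b₁, hb₁, hb₁'⟩, ⟨b₂, hb₂, hb₂'⟩⟩ := hcon
  -- `b₁`: path avoids `W₁`, meets `W₂` at `v₁`; `b₂`: path avoids `W₂`, meets `W₁` at `v₂`
  simp only [avoidB, Finset.mem_filter, not_and, not_forall, not_not] at hb₁ hb₁' hb₂ hb₂'
  obtain ⟨v₁, hv₁p, hv₁W₂⟩ := hb₁' hb₁.1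
  obtain ⟨v₂, hv₂p, hv₂W₁⟩ := hb₂' hb₂.1
  have hav₁ := hb₁.2
  have hav₂ := hb₂.2
  -- the chosen paths exist (nonempty `pathVerts`)
  have hr₁ : (ForestCluster.allG ends).Reachable t b₁ := by
    by_contra hr; unfold pathVerts at hv₁p; rw [dif_neg hr] at hv₁p; exact Finset.notMem_empty _ hv₁p
  have hr₂ : (ForestCluster.allG ends).Reachable t b₂ := by
    by_contra hr; unfold pathVerts at hv₂p; rw [dif_neg hr] at hv₂p; exact Finset.notMem_empty _ hv₂p
  set q₁ := (tbPath ends t b₁ hr₁).1 with hq₁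
  set q₂ := (tbPath ends t b₂ hr₂).1 with hq₂
  have hv₁q : v₁ ∈ q₁.support := by
    unfold pathVerts at hv₁p; rw [dif_pos hr₁] at hv₁p; exact List.mem_toFinset.1 hv₁p
  have hv₂q : v₂ ∈ q₂.support := by
    unfold pathVerts at hv₂p; rw [dif_pos hr₂] at hv₂p; exact List.mem_toFinset.1 hv₂p
  have hP₁ : ∀ v ∈ q₁.support, v ∉ W₁ := fun v hv => hav₁ v (by
    unfold pathVerts; rw [dif_pos hr₁]; exact List.mem_toFinset.2 hv)
  have hP₂ : ∀ v ∈ q₂.support, v ∉ W₂ := fun v hv => hav₂ v (by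
    unfold pathVerts; rw [dif_pos hr₂]; exact List.mem_toFinset.2 hv)
  -- walk from `v₁` to `v₂` inside `W₁ ∪ W₂`
  obtain ⟨r₁, hr₁'⟩ := h₂.2 v₁ hv₁W₂
  obtain ⟨r₂, hr₂'⟩ := h₁.2 v₂ hv₂W₁
  set wW : (ForestCluster.allG ends).Walk v₁ v₂ := r₁.reverse.append r₂ with hwW
  have hwW_sup : ∀ v ∈ wW.support, v ∈ W₁ ∪ W₂ := by
    intro v hv
    rw [hwW, SimpleGraph.Walk.mem_support_append_iff, SimpleGraph.Walk.support_reverse,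
      List.mem_reverse] at hv
    rcases hv with hv | hv
    · exact Finset.mem_union_right _ (hr₁' v hv)
    · exact Finset.mem_union_left _ (hr₂' v hv)
  -- walk from `v₁` to `v₂` inside the two paths
  set wP : (ForestCluster.allG ends).Walk v₁ v₂ :=
    (q₁.takeUntil v₁ hv₁q).reverse.append (q₂.takeUntil v₂ hv₂q) with hwP
  have hwP_sup : ∀ v ∈ wP.support, v ∈ q₁.support ∨ v ∈ q₂.support := by
    intro v hv
    rw [hwP, SimpleGraph.Walk.mem_support_append_iff, SimpleGraph.Walk.support_reverse,
      List.mem_reverse] at hv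
    rcases hv with hv | hv
    · exact Or.inl (q₁.support_takeUntil_subset_support hv₁q hv)
    · exact Or.inr (q₂.support_takeUntil_subset_support hv₂q hv)
  -- the two walks have the same path
  have huniq := hF.2.path_unique wW.toPath wP.toPath
  have hval : (wW.toPath : (ForestCluster.allG ends).Walk v₁ v₂) =
      (wP.toPath : (ForestCluster.allG ends).Walk v₁ v₂) := congrArg Subtype.val huniq
  have hπW : ∀ v ∈ (wW.toPath : (ForestCluster.allG ends).Walk v₁ v₂).support, v ∈ W₁ ∪ W₂ :=
    fun v hv => hwW_sup v (wW.support_toPath_subset_support hv)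
  have hπP : ∀ v ∈ (wW.toPath : (ForestCluster.allG ends).Walk v₁ v₂).support,
      v ∈ q₁.support ∨ v ∈ q₂.support := by
    intro v hv
    rw [hval] at hv
    exact hwP_sup v (wP.support_toPath_subset_support hv)
  -- a boundary dart of the path for the vertex set of `q₁`
  have hv₂notq₁ : v₂ ∉ ({v | v ∈ q₁.support} : Set V) := fun h => hP₁ v₂ h hv₂W₁
  obtain ⟨d, hd, hd1, hd2⟩ := (wW.toPath : (ForestCluster.allG ends).Walk v₁ v₂).exists_boundary_dart
    {v | v ∈ q₁.support} hv₁q hv₂notq₁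
  have hx : d.fst ∈ (wW.toPath : (ForestCluster.allG ends).Walk v₁ v₂).support :=
    SimpleGraph.Walk.dart_fst_mem_support_of_mem_darts _ hd
  have hy : d.snd ∈ (wW.toPath : (ForestCluster.allG ends).Walk v₁ v₂).support :=
    SimpleGraph.Walk.dart_snd_mem_support_of_mem_darts _ hd
  have hxW₂ : d.fst ∈ W₂ := by
    rcases Finset.mem_union.1 (hπW _ hx) with h | h
    · exact absurd h (hP₁ _ hd1)
    · exact h
  have hxW₁ : d.fst ∉ W₁ := hP₁ _ hd1
  have hyq₂ : d.snd ∈ q₂.support := by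
    rcases hπP _ hy with h | h
    · exact absurd h hd2
    · exact h
  have hyW₂ : d.snd ∉ W₂ := hP₂ _ hyq₂
  have hyW₁ : d.snd ∈ W₁ := by
    rcases Finset.mem_union.1 (hπW _ hy) with h | h
    · exact h
    · exact absurd h hyW₂
  exact ForestCluster.no_cross_edge hF h₂ h₁ d.adj hxW₂ hxW₁ hyW₁ hyW₂


end GateForestPaths

end Summit.Ventures.PercRepro2
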